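import Literature.NumberTheory.EllipticCurves.EisensteinNewformLevelRaisingOrdinaryProofs
import Literature.NumberTheory.GaloisRepresentations.LocalKroneckerWeberInertiaProofs
import HarnessLib

/-!
# Hida 2000, Thm. 3.26 (2): the `ℚ̄_p`-form descends to the `λ`-adic representations (proofs only)

A theorems-only companion (no definition, no named fact; D-0026) of
`EisensteinNewformLevelRaisingOrdinaryProofs.lean`, written by the seat of the named fact
`Literature.NumberTheory.EllipticCurves.Hida2000_thm326_ordinary` (Hida, *Modular Forms and Galois
Cohomology* (2000), Thm. 3.26 (2), p. 152 — printed there without proof; proofs: Wiles 1988,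
Thm. 2.1.4 / 2.2, Mazur–Wiles 1986, Prop. 2).  That file shows that the `λ`-adic shapes of the
theorem — an ordinary frame of `ρ_{g,v} : Gal(ℚ̄/ℚ) → GL₂((K_g)_v)` at a place `v ∋ p` of the
coefficient field with `v(a_p) = 1` — imply the tree's `ℚ̄_p`-form
(`Hida2000_thm326_ordinary_of_newformPlaces`, `…_of_eigenformPlaces`).  Here is the CONVERSE:

* `exists_frame_descent` — linear algebra: if a family of matrices `M i ∈ GL₂(A)` becomes
  simultaneously upper triangular over a field extension `f : A → B`, in a frame in which some
  `M i₀` has diagonal `(a, 1)` with `a ≠ 1`, then it is simultaneously upper triangular over `A`,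
  with the same diagonals: the `B`-line of the frame is the kernel of `f(M i₀ − det M i₀)`, whose
  `A`-rational kernel is an `A`-line stable under every `M i`.
* `Hida2000_thm326_ordinary.exists_frame_adicCompletion` — granted the fact, for a newform `g`,
  `k ≥ 2`, a place `v` of `K_g` above `p ∤ N` with `v(a_p(g)) = 1`, EVERY continuous
  `ρ : Gal(ℚ̄/ℚ) → GL₂((K_g)_v)` attached to `g` through `K_g → (K_g)_v` away from `N p` is upper
  triangular on `Γ_{ℚ_p}` in a `(K_g)_v`-rational frame with lower-right entry `1` on inertia:
  embed `(K_g)_v` into `ℚ̄_p` over an embedding `j : K_g → ℚ̄_p` inducing `v`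
  (`exists_ringHom_padicAlgCl_of_heightOneSpectrum`, `exists_continuous_ringHom_adicCompletion_padicAlgCl`;
  Neukirch, ANT II §8), choose `ι : ℚ̄_p ≃ ℂ` extending `K_g ⊆ ℂ` along `j` (Steinitz,
  `exists_ringEquiv_padicAlgCl_complex_extends`), apply the fact to `ρ ⊗ ℚ̄_p` (attached through
  `ι⁻¹ ∘ (K_g ⊆ ℂ)`, irreducible by Ribet's Thm. (2.3) — proved in the tree — and `p`-ordinary
  since `|ι⁻¹ a_p|_p = 1 ↔ v(a_p) = 1`), and descend the frame: its inertial diagonal is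
  `(ν^{k-1}, 1)` and `ν(I_{ℚ_p}) = ℤ_pˣ` (`ℚ_p(μ_{p^∞})/ℚ_p` totally ramified,
  `adicCompletion_rat_exists_mem_absInertia_cyclotomicCharacter_eq`; Serre, *Local Fields* IV §4,
  Prop. 17) contains an element no positive power of which is `1`.
* `Hida2000_thm326_ordinary_iff_newformPlaces` — hence, granted Deligne's theorem at the places of
  the coefficient fields of newforms (the `newformPlaces` shape of
  `DeligneSerre1974.thm61_exists_adicGaloisRep`, equivalent to it and to Hida's Thm. 3.26 (1) by
  `NewformGaloisRepThm61OfNewformProofs.lean`), the fact `Hida2000_thm326_ordinary` is EQUIVALENT to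
  its `λ`-adic newform-places shape (Wiles 1988, Thm. 2.1.4, for `ρ_{f,λ}` over `K_{f,λ}`, bare
  inertial content): the fact is an apex FORM of the printed theorem, not a corollary below it.

## References

* H. Hida, *Modular Forms and Galois Cohomology*, CUP (2000), Thm. 3.26 (2), p. 152. [Hida2000]
* A. Wiles, *On ordinary `λ`-adic representations associated to modular forms*, Invent. Math. 94
  (1988), 529–573, Thm. 2.1.4 and Thm. 2.2.
* B. Mazur, A. Wiles, *On `p`-adic analytic families of Galois representations*, Compositio Math.
  59 (1986), 231–264, Prop. 2.
* J. Neukirch, *Algebraic Number Theory* (1999), Ch. II §8 with (8.1)–(8.2). [NeukirchANT1999]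
* J.-P. Serre, *Local Fields*, GTM 67 (1979), Ch. IV §4, Prop. 17. [SerreLocalFields1979]
* K. A. Ribet, *Galois representations attached to eigenforms with Nebentypus*, LNM 601 (1977),
  Thm. (2.3). [Ribet1977Nebentypus]
-/

noncomputable section

open scoped MatrixGroups Matrix ModularForm NumberField

open CongruenceSubgroup UpperHalfPlane Polynomial IsDedekindDomain Field

namespace Literature.NumberTheory.EllipticCurves

open Literature.NumberTheory.GaloisRepresentations Literature.NumberTheory.EllipticCurves.ModularForms
open Rat.HeightOneSpectrum

/-! ### Descent of a simultaneous upper-triangular frame along a field extension -/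

section FrameDescent

variable {A B : Type*} [Field A] [Field B]

/-- Entries of `M v` for a `2 × 2` matrix. [folklore] -/
theorem mulVec_fin_two_apply {R : Type*} [CommRing R] (M : Matrix (Fin 2) (Fin 2) R)
    (v : Fin 2 → R) (i : Fin 2) : (M *ᵥ v) i = M i 0 * v 0 + M i 1 * v 1 := by
  simp [Matrix.mulVec, dotProduct, Fin.sum_univ_two]

/-- The determinant of an upper-triangular `2 × 2` matrix. [folklore] -/
theorem det_fin_two_of_apply_one_zero_eq_zero {R : Type*} [CommRing R]
    {M : Matrix (Fin 2) (Fin 2) R} (h : M 1 0 = 0) : M.det = M 0 0 * M 1 1 := by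
  rw [Matrix.det_fin_two, h, mul_zero, sub_zero]

/-- A `2 × 2` frame with prescribed columns `u, w` (when `det (u | w) ≠ 0`). [folklore] -/
theorem exists_generalLinearGroup_cols (u w : Fin 2 → A) (h : u 0 * w 1 - w 0 * u 1 ≠ 0) :
    ∃ Q : GL (Fin 2) A, ∀ c : Fin 2 → A, Q.val *ᵥ c = c 0 • u + c 1 • w := by
  let Qm : Matrix (Fin 2) (Fin 2) A := Matrix.of fun r s ↦ if s = 0 then u r else w r
  have hdet : Qm.det ≠ 0 := by
    rw [Matrix.det_fin_two]
    simpa [Qm] using h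
  refine ⟨Matrix.GeneralLinearGroup.mkOfDetNeZero Qm hdet, fun c ↦ ?_⟩
  funext r
  change (Qm *ᵥ c) r = _
  rw [mulVec_fin_two_apply]
  fin_cases r <;> simp [Qm, mul_comm]

/-- `N u = 0` may be tested after an (injective) change of fields `f`. [folklore] -/
theorem mulVec_eq_zero_iff_map {n : Type*} [Fintype n] (f : A →+* B)
    (N : Matrix n n A) (u : n → A) : N *ᵥ u = 0 ↔ N.map f *ᵥ (f ∘ u) = 0 := by
  constructor
  · intro h
    funext i
    rw [← RingHom.map_mulVec, h, Pi.zero_apply, map_zero, Pi.zero_apply]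
  · intro h
    funext i
    have := congr_fun h i
    rw [← RingHom.map_mulVec, Pi.zero_apply, map_eq_zero_iff f f.injective] at this
    rw [this, Pi.zero_apply]

/-- `f (N u) = f(N) f(u)` as vectors (Mathlib `RingHom.map_mulVec`, pointwise). [folklore] -/
theorem map_comp_mulVec {n : Type*} [Fintype n] (f : A →+* B) (N : Matrix n n A) (u : n → A) :
    f ∘ (N *ᵥ u) = N.map f *ᵥ (f ∘ u) := by
  funext i
  exact RingHom.map_mulVec f N u i

/-- **Descent of an upper-triangular frame along a field embedding.**  Let `f : A → B` be a
homomorphism of fields, `M : ι → GL₂(A)` a family of matrices which over `B` is simultaneously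
upper triangular in a frame `Q'`, and suppose some member `M i₀` has, in that frame, lower-right
entry `1` and upper-left entry `≠ 1`.  Then the family is already simultaneously upper triangular
in a frame `Q` over `A`, with the same diagonal entries (under `f`).  Proof: the `B`-line `Q' e₀`
is the kernel of `f(M i₀ − det(M i₀))`, a matrix defined over `A`; its `A`-rational kernel is an
`A`-line stable under every `M i`, and any frame through it works. [folklore] -/
theorem exists_frame_descent (f : A →+* B) {ι : Type*} (M : ι → GL (Fin 2) A)
    (Q' : GL (Fin 2) B)
    (hQ' : ∀ i, (Q'⁻¹ * Matrix.GeneralLinearGroup.map f (M i) * Q').val 1 0 = 0)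
    {i₀ : ι} (h11 : (Q'⁻¹ * Matrix.GeneralLinearGroup.map f (M i₀) * Q').val 1 1 = 1)
    (h00 : (Q'⁻¹ * Matrix.GeneralLinearGroup.map f (M i₀) * Q').val 0 0 ≠ 1) :
    ∃ Q : GL (Fin 2) A, ∀ i, (Q⁻¹ * M i * Q).val 1 0 = 0 ∧
      f ((Q⁻¹ * M i * Q).val 0 0) =
        (Q'⁻¹ * Matrix.GeneralLinearGroup.map f (M i) * Q').val 0 0 ∧
      f ((Q⁻¹ * M i * Q).val 1 1) =
        (Q'⁻¹ * Matrix.GeneralLinearGroup.map f (M i) * Q').val 1 1 := by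
  classical
  -- the frame over `B`
  set P' : Matrix (Fin 2) (Fin 2) B := (Q'⁻¹).val with hP'
  set R' : Matrix (Fin 2) (Fin 2) B := Q'.val with hR'
  have hPR : P' * R' = 1 := by rw [hP', hR', ← Units.val_mul, inv_mul_cancel, Units.val_one]
  have hRP : R' * P' = 1 := by rw [hP', hR', ← Units.val_mul, mul_inv_cancel, Units.val_one]
  set A' : ι → Matrix (Fin 2) (Fin 2) B := fun i ↦ P' * (M i).val.map f * R' with hA'def
  have hA' : ∀ i, (Q'⁻¹ * Matrix.GeneralLinearGroup.map f (M i) * Q').val = A' i := fun i ↦ rfl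
  have hA'10 : ∀ i, A' i 1 0 = 0 := fun i ↦ by rw [← hA']; exact hQ' i
  have hM' : ∀ i, (M i).val.map f = R' * A' i * P' := by
    intro i
    simp only [hA'def, ← Matrix.mul_assoc, hRP, Matrix.one_mul]
    rw [Matrix.mul_assoc, hRP, Matrix.mul_one]
  -- the line `L' = Q' e₀ = {x | (P' x)₁ = 0}` is stable under every `f(M i)`
  have hPM : ∀ i x, P' *ᵥ ((M i).val.map f *ᵥ x) = A' i *ᵥ (P' *ᵥ x) := by
    intro i x
    simp only [hA'def, Matrix.mulVec_mulVec]
    rw [Matrix.mul_assoc (P' * _), hRP, Matrix.mul_one]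
  have hstab : ∀ i x, (P' *ᵥ x) 1 = 0 → (P' *ᵥ ((M i).val.map f *ᵥ x)) 1 = 0 := by
    intro i x hx
    rw [hPM, mulVec_fin_two_apply, hA'10, hx, zero_mul, mul_zero, add_zero]
  -- the distinguished element: `A' i₀ = (a ∗; 0 1)`, `a ≠ 1`, `a = f (det M i₀)`
  set a : B := A' i₀ 0 0 with ha
  have ha1 : a ≠ 1 := by rw [ha, ← hA']; exact h00
  have h11' : A' i₀ 1 1 = 1 := by rw [← hA']; exact h11
  have hdetRP : R'.det * P'.det = 1 := by rw [← Matrix.det_mul, hRP, Matrix.det_one]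
  have hdetA' : ∀ i, (A' i).det = ((M i).val.map f).det := by
    intro i
    change (P' * (M i).val.map f * R').det = _
    rw [Matrix.det_mul, Matrix.det_mul, mul_comm P'.det, mul_assoc, mul_comm P'.det, hdetRP,
      mul_one]
  set d₀ : A := (M i₀).val.det with hd₀
  have hfd : f d₀ = a := by
    rw [hd₀, RingHom.map_det, RingHom.mapMatrix_apply, ← hdetA',
      det_fin_two_of_apply_one_zero_eq_zero (hA'10 i₀), h11', mul_one]
  -- `N₀ = M i₀ - det (M i₀)`, `f(N₀) = R' C P'` with `C = A' i₀ - a = (0 ∗; 0 1-a)`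
  set N₀ : Matrix (Fin 2) (Fin 2) A := (M i₀).val - d₀ • (1 : Matrix (Fin 2) (Fin 2) A) with hN₀
  set C : Matrix (Fin 2) (Fin 2) B := A' i₀ - a • (1 : Matrix (Fin 2) (Fin 2) B) with hC
  have hN₀map : N₀.map f = (M i₀).val.map f - a • (1 : Matrix (Fin 2) (Fin 2) B) := by
    ext r s
    fin_cases r <;> fin_cases s <;> simp [hN₀, hfd]
  have hN₀' : N₀.map f = R' * C * P' := by
    rw [hN₀map, hC, Matrix.mul_sub, Matrix.sub_mul, ← hM', Matrix.mul_smul, Matrix.smul_mul,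
      Matrix.mul_one, hRP]
  have hC00 : C 0 0 = 0 := by simp [hC, ha]
  have hC10 : C 1 0 = 0 := by simp [hC, hA'10]
  have hC11 : C 1 1 = 1 - a := by simp [hC, h11']
  -- `ker f(N₀) = L'`
  have hR'inj : ∀ z : Fin 2 → B, R' *ᵥ z = 0 → z = 0 := by
    intro z hz
    have : P' *ᵥ (R' *ᵥ z) = z := by rw [Matrix.mulVec_mulVec, hPR, Matrix.one_mulVec]
    rw [← this, hz, Matrix.mulVec_zero]
  have hker : ∀ x, N₀.map f *ᵥ x = 0 ↔ (P' *ᵥ x) 1 = 0 := by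
    intro x
    rw [hN₀', ← Matrix.mulVec_mulVec, ← Matrix.mulVec_mulVec]
    constructor
    · intro h
      have h1 := congr_fun (hR'inj _ h) 1
      rw [mulVec_fin_two_apply, hC10, hC11, zero_mul, zero_add, Pi.zero_apply] at h1
      rcases mul_eq_zero.mp h1 with h1 | h1
      · exact absurd (sub_eq_zero.mp h1).symm ha1
      · exact h1
    · intro h
      have : C *ᵥ (P' *ᵥ x) = 0 := by
        funext r
        rw [mulVec_fin_two_apply, h, mul_zero, add_zero, Pi.zero_apply]
        revert r
        rw [Fin.forall_fin_two, hC00, hC10, zero_mul]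
        exact ⟨rfl, rfl⟩
      rw [this, Matrix.mulVec_zero]
  -- hence `ker N₀` (over `A`) is stable under every `M i`
  have hkerStab : ∀ i u, N₀ *ᵥ u = 0 → N₀ *ᵥ ((M i).val *ᵥ u) = 0 := by
    intro i u hu
    rw [mulVec_eq_zero_iff_map f, map_comp_mulVec, hker]
    apply hstab
    rw [← hker, ← mulVec_eq_zero_iff_map f]
    exact hu
  -- `N₀` is singular and non-zero
  have hdetN₀ : N₀.det = 0 := by
    apply f.injective
    rw [RingHom.map_det, RingHom.mapMatrix_apply, hN₀', Matrix.det_mul, Matrix.det_mul,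
      mul_comm R'.det, mul_assoc, hdetRP, mul_one, map_zero, Matrix.det_fin_two, hC00, hC10]
    ring
  have hN₀ne : N₀ ≠ 0 := by
    intro h0
    have h1 : (P' *ᵥ (R' *ᵥ (Pi.single 1 1 : Fin 2 → B))) 1 = 0 := by
      rw [← hker, h0, Matrix.map_zero f (map_zero f), Matrix.zero_mulVec]
    rw [Matrix.mulVec_mulVec, hPR, Matrix.one_mulVec] at h1
    simp at h1
  obtain ⟨u₁, hu₁, hNu₁⟩ := Matrix.exists_mulVec_eq_zero_iff.mpr hdetN₀
  obtain ⟨j, hj⟩ : ∃ j : Fin 2, N₀ *ᵥ Pi.single j 1 ≠ 0 := by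
    by_contra hall
    push Not at hall
    apply hN₀ne
    ext r s
    have := congr_fun (hall s) r
    rwa [Matrix.mulVec_single_one, Matrix.col_apply] at this
  -- a frame `Q = (u₁ | e_j)` over `A`
  set w : Fin 2 → A := Pi.single j 1 with hw
  have hind : u₁ 0 * w 1 - w 0 * u₁ 1 ≠ 0 := by
    -- otherwise `u₁ ∈ A e_j`, forcing `N₀ e_j = 0`
    intro h0
    apply hj
    have key : ∃ t : A, t ≠ 0 ∧ u₁ = t • w := by
      fin_cases j
      · have h1 : u₁ 1 = 0 := by simpa [hw] using h0
        refine ⟨u₁ 0, fun h ↦ hu₁ ?_, ?_⟩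
        · funext r; fin_cases r <;> simp [h, h1]
        · funext r; fin_cases r <;> simp [hw, h1]
      · have h1 : u₁ 0 = 0 := by simpa [hw] using h0
        refine ⟨u₁ 1, fun h ↦ hu₁ ?_, ?_⟩
        · funext r; fin_cases r <;> simp [h, h1]
        · funext r; fin_cases r <;> simp [hw, h1]
    obtain ⟨t, ht, hu⟩ := key
    have : N₀ *ᵥ u₁ = t • (N₀ *ᵥ w) := by rw [hu, Matrix.mulVec_smul]
    rw [hNu₁] at this
    exact ((smul_eq_zero.mp this.symm).resolve_left ht)
  obtain ⟨Q, hQ⟩ := exists_generalLinearGroup_cols u₁ w hind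
  have hQe₀ : Q.val *ᵥ Pi.single 0 1 = u₁ := by rw [hQ]; simp
  have hQinv : ∀ y, Q.val *ᵥ ((Q⁻¹).val *ᵥ y) = y := fun y ↦ by
    rw [Matrix.mulVec_mulVec, ← Units.val_mul, mul_inv_cancel, Units.val_one, Matrix.one_mulVec]
  refine ⟨Q, fun i ↦ ?_⟩
  -- coordinates of `M i u₁` in the frame: `c = (c₀, 0)`
  set c : Fin 2 → A := (Q⁻¹).val *ᵥ ((M i).val *ᵥ u₁) with hc
  have hMu : (M i).val *ᵥ u₁ = c 0 • u₁ + c 1 • w := by rw [← hQ, hc, hQinv]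
  have hc1 : c 1 = 0 := by
    have h := hkerStab i u₁ hNu₁
    rw [hMu, Matrix.mulVec_add, Matrix.mulVec_smul, Matrix.mulVec_smul, hNu₁, smul_zero,
      zero_add] at h
    exact (smul_eq_zero.mp h).resolve_right hj
  have hentry : ∀ r, (Q⁻¹ * M i * Q).val r 0 = c r := by
    intro r
    have : (Q⁻¹ * M i * Q).val *ᵥ Pi.single 0 1 = c := by
      rw [Units.val_mul, Units.val_mul, ← Matrix.mulVec_mulVec, ← Matrix.mulVec_mulVec, hQe₀]
    rw [← this, Matrix.mulVec_single_one, Matrix.col_apply]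
  have h10 : (Q⁻¹ * M i * Q).val 1 0 = 0 := by rw [hentry, hc1]
  -- upper-left entries match: both are the eigenvalue on the line
  have hMu' : (M i).val *ᵥ u₁ = c 0 • u₁ := by rw [hMu, hc1, zero_smul, add_zero]
  set x : Fin 2 → B := f ∘ u₁ with hx
  have hx0 : x ≠ 0 := by
    intro h
    apply hu₁
    funext r
    have := congr_fun h r
    simp only [hx, Function.comp_apply, Pi.zero_apply, map_eq_zero_iff f f.injective] at this
    exact this
  have hxL : (P' *ᵥ x) 1 = 0 := by
    rw [← hker, hx, ← map_comp_mulVec, hNu₁]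
    funext r
    simp
  have hM'x : (M i).val.map f *ᵥ x = f (c 0) • x := by
    rw [hx, ← map_comp_mulVec, hMu']
    funext r
    simp
  have hM'x' : (M i).val.map f *ᵥ x = A' i 0 0 • x := by
    have h1 : P' *ᵥ ((M i).val.map f *ᵥ x) = A' i 0 0 • (P' *ᵥ x) := by
      rw [hPM]
      funext r
      rw [mulVec_fin_two_apply, hxL, mul_zero, add_zero, Pi.smul_apply, smul_eq_mul]
      fin_cases r
      · rfl
      · change A' i 1 0 * _ = A' i 0 0 * (P' *ᵥ x) 1
        rw [hA'10, hxL, zero_mul, mul_zero]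
    have h2 : R' *ᵥ (P' *ᵥ ((M i).val.map f *ᵥ x)) = (M i).val.map f *ᵥ x := by
      rw [Matrix.mulVec_mulVec, hRP, Matrix.one_mulVec]
    rw [← h2, h1, Matrix.mulVec_smul, Matrix.mulVec_mulVec, hRP, Matrix.one_mulVec]
  have h00' : f ((Q⁻¹ * M i * Q).val 0 0) = A' i 0 0 := by
    rw [hentry]
    have h := hM'x.symm.trans hM'x'
    rw [← sub_eq_zero, ← sub_smul, smul_eq_zero] at h
    exact sub_eq_zero.mp (h.resolve_right hx0)
  refine ⟨h10, h00', ?_⟩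
  -- lower-right entries match: determinants
  have hdetB : ((Q⁻¹ * M i * Q).val).det = (M i).val.det := by
    rw [Units.val_mul, Units.val_mul, Matrix.det_mul, Matrix.det_mul, mul_comm (Q⁻¹).val.det,
      mul_assoc, ← Matrix.det_mul, ← Units.val_mul, inv_mul_cancel, Units.val_one, Matrix.det_one,
      mul_one]
  have hdetMi : (M i).val.det ≠ 0 := by
    rw [← Matrix.GeneralLinearGroup.val_det_apply]
    exact Units.ne_zero _
  have hB00 : (Q⁻¹ * M i * Q).val 0 0 ≠ 0 := by
    intro h0
    apply hdetMi
    rw [← hdetB, det_fin_two_of_apply_one_zero_eq_zero h10, h0, zero_mul]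
  have key : f ((Q⁻¹ * M i * Q).val 0 0) * f ((Q⁻¹ * M i * Q).val 1 1) =
      f ((Q⁻¹ * M i * Q).val 0 0) * A' i 1 1 := by
    rw [← map_mul, ← det_fin_two_of_apply_one_zero_eq_zero h10, hdetB, RingHom.map_det,
      RingHom.mapMatrix_apply, ← hdetA', det_fin_two_of_apply_one_zero_eq_zero (hA'10 i), h00']
  exact mul_left_cancel₀ ((map_ne_zero f).mpr hB00) key

end FrameDescent

/-! ### The converse: `(K_g)_v`-rational ordinary frames from the `ℚ̄_p`-form -/

section AdicShapeConverse

open Literature.NumberTheory.EllipticCurves.ModularForms.DeligneSerre1974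

variable {N : ℕ} [NeZero N] {k : ℤ}

/-- **Converse: the `ℚ̄_p`-form descends to every `λ`-adic representation.**  Granted
`Hida2000_thm326_ordinary`, for a newform `g ∈ S_k(Γ₁(N))`, `k ≥ 2`, a finite place `v` of
`K_g` above `p ∤ N` with `v(a_p(g)) = 1` and the place `w = p` of `ℚ`, EVERY continuous
`ρ : Gal(ℚ̄/ℚ) → GL₂((K_g)_v)` attached to `g` through `K_g → (K_g)_v` away from `N p` is upper
triangular on `Γ_{ℚ_p}` in some `(K_g)_v`-rational frame with lower-right entry `1` on inertia.
Proof: choose `j : K_g → ℚ̄_p` inducing `v` (`exists_ringHom_padicAlgCl_of_heightOneSpectrum`,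
Neukirch II (8.1)–(8.2)), `ι : ℚ̄_p ≃ ℂ` extending `K_g ⊆ ℂ` along `j` (Steinitz,
`exists_ringEquiv_padicAlgCl_complex_extends`) and the continuous `φ : (K_g)_v → ℚ̄_p` extending
`j`; then `ρ ⊗_φ ℚ̄_p` is attached to `g` through `ι⁻¹ ∘ (K_g ⊆ ℂ)` and irreducible (Ribet's
Thm. (2.3)), and `|ι⁻¹ a_p|_p = 1`, so the fact gives a `ℚ̄_p`-frame `Q'` with inertial diagonal
`(ν^{k-1}, 1)`; since `χ_p(I_{ℚ_p}) = ℤ_pˣ` (`adicCompletion_rat_exists_mem_absInertia_cyclotomicCharacter_eq`)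
some `σ₀ ∈ I_{ℚ_p}` has `ν(σ₀)^{k-1} ≠ 1`, and the frame descends (`exists_frame_descent`).
[cite: Hida2000, Thm. 3.26 (2), p. 152] [cite: NeukirchANT1999, Ch. II (8.1)–(8.2)] -/
theorem Hida2000_thm326_ordinary.exists_frame_adicCompletion (h : Hida2000_thm326_ordinary)
    {g : CuspForm (Gamma1 N) k} (hk : 2 ≤ k) (hg : IsNewform1 g) [NumberField (coeffCharField g)]
    (v : HeightOneSpectrum (𝓞 (coeffCharField g))) {p : ℕ} (hp : p.Prime)
    (hpv : ((p : ℕ) : 𝓞 (coeffCharField g)) ∈ v.asIdeal) (hpN : ¬ p ∣ N)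
    (hord : v.valuation (coeffCharField g)
      ⟨(qExpansion 1 ⇑g).coeff p, cuspCoeff_mem_coeffCharField g p⟩ = 1)
    {w : HeightOneSpectrum (𝓞 ℚ)} (hw : (p : 𝓞 ℚ) ∈ w.asIdeal)
    {ρ : FramedGaloisRep ℚ (v.adicCompletion (coeffCharField g)) 2}
    (hρ : IsGaloisRepOfNewform1 g
      (algebraMap (coeffCharField g) (v.adicCompletion (coeffCharField g))) {q | q ∣ N * p} ρ) :
    ∃ Q : GL (Fin 2) (v.adicCompletion (coeffCharField g)), ∀ σ,
      (Q⁻¹ * ρ.toLocal w σ * Q).val 1 0 = 0 ∧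
      (σ ∈ absInertia (w.adicCompletion ℚ) → (Q⁻¹ * ρ.toLocal w σ * Q).val 1 1 = 1) := by
  classical
  haveI : Fact p.Prime := ⟨hp⟩
  -- `j : K_g → ℚ̄_p` inducing `v`, `ι : ℚ̄_p ≃ ℂ` extending `K_g ⊆ ℂ`, `φ : (K_g)_v → ℚ̄_p`
  obtain ⟨j, hj, hjv⟩ := exists_ringHom_padicAlgCl_of_heightOneSpectrum (ℓ := p) v hpv
  obtain ⟨ι, hι⟩ := exists_ringEquiv_padicAlgCl_complex_extends j (algebraMap (coeffCharField g) ℂ)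
  have hιj : (ι.symm : ℂ →+* PadicAlgCl p).comp (algebraMap (coeffCharField g) ℂ) = j := by
    ext x
    change ι.symm (algebraMap (coeffCharField g) ℂ x) = j x
    rw [← hι x, RingEquiv.symm_apply_apply]
  obtain ⟨φ, hφc, hφj⟩ := exists_continuous_ringHom_adicCompletion_padicAlgCl j v hpv hjv
  have hφcomp : φ.comp (algebraMap (coeffCharField g) (v.adicCompletion (coeffCharField g))) = j := RingHom.ext hφj
  -- the base change `ρ ⊗_φ ℚ̄_p`: attached through `ι⁻¹ ∘ (K_g ⊆ ℂ)`, irreducible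
  letI := GaloisRepresentations.LocalField.adicCompletionPadicAlgebra v p hpv
  haveI := finiteDimensional_padic_adicCompletion v p hpv
  haveI := isModuleTopology_padic_adicCompletion v p hpv
  have hρ' : IsGaloisRepOfNewform1 g ((ι.symm : ℂ →+* PadicAlgCl p).comp (algebraMap (coeffCharField g) ℂ))
      {q | q ∣ N * p} (FramedRep.baseChange φ hφc ρ) := by
    rw [hιj, ← hφcomp]
    exact hρ.baseChange φ hφc
  have habs : FramedRep.IsAbsolutelyIrreducible ρ :=
    Ribet1977.isAbsolutelyIrreducible_of_thm23 Ribet1977.thm23_isIrreducible_holds hg (by omega) hρ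
  -- ordinarity on the `ℚ̄_p` side
  have hap : Valued.v (ι.symm ((qExpansion 1 ⇑g).coeff p)) = 1 := by
    have : ι.symm ((qExpansion 1 ⇑g).coeff p) =
        j ⟨(qExpansion 1 ⇑g).coeff p, cuspCoeff_mem_coeffCharField g p⟩ := by
      rw [← hιj]; rfl
    rw [this, valued_eq_one_iff_valuation_eq_one j v hpv hjv]
    exact hord
  -- the `ℚ̄_p`-frame of the fact
  obtain ⟨Q', hQ'⟩ :=
    h g hk hg p ι hpN hap (FramedRep.baseChange φ hφc ρ) hρ' (habs (PadicAlgCl p) φ) w hw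
  -- an inertia element with `ν^{k-1} ≠ 1`
  have hgen : ((primesEquiv w : Nat.Primes) : ℕ) = p := by
    have hdvd : natGenerator w ∣ p := (Rat.natCast_mem_asIdeal_iff w).mp hw
    exact (Nat.prime_dvd_prime_iff_eq (primesEquiv w).2 hp).mp hdvd
  obtain ⟨u, hu⟩ := exists_unit_pow_ne_one p
  obtain ⟨σ₀, hσ₀, hνσ₀⟩ :=
    adicCompletion_rat_exists_mem_absInertia_cyclotomicCharacter_eq p w hgen u
  -- the frame of `ρ ⊗_φ ℚ̄_p` restricted to `Γ_{ℚ_w}`, read on `φ(ρ|_{Γ_{ℚ_w}})`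
  have hQ'' : ∀ σ, (Q'⁻¹ * Matrix.GeneralLinearGroup.map φ (ρ.toLocal w σ) * Q').val 1 0 = 0 ∧
      (σ ∈ absInertia (w.adicCompletion ℚ) →
        (Q'⁻¹ * Matrix.GeneralLinearGroup.map φ (ρ.toLocal w σ) * Q').val 1 1 = 1 ∧
        (Q'⁻¹ * Matrix.GeneralLinearGroup.map φ (ρ.toLocal w σ) * Q').val 0 0 =
          algebraMap ℚ_[p] (PadicAlgCl p)
            ((GaloisRep.cyclotomicCharacter (w.adicCompletion ℚ) p σ : ℤ_[p]) : ℚ_[p]) ^ (k - 1)) :=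
    fun σ ↦ hQ' σ
  have h00 : (Q'⁻¹ * Matrix.GeneralLinearGroup.map φ (ρ.toLocal w σ₀) * Q').val 0 0 ≠ 1 := by
    rw [((hQ'' σ₀).2 hσ₀).2, hνσ₀]
    obtain ⟨m, hm⟩ : ∃ m : ℕ, (m : ℤ) = k - 1 := ⟨(k - 1).toNat, Int.toNat_of_nonneg (by omega)⟩
    have hm0 : 0 < m := by omega
    rw [← hm, zpow_natCast, ← map_pow, Ne,
      map_eq_one_iff _ (algebraMap ℚ_[p] (PadicAlgCl p)).injective]
    intro h1
    apply hu m hm0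
    apply Units.ext
    apply PadicInt.ext
    rw [Units.val_pow_eq_pow_val, Units.val_one, PadicInt.coe_pow, PadicInt.coe_one]
    exact h1
  -- descent of the frame to `(K_g)_v`
  obtain ⟨Q, hQ⟩ := exists_frame_descent φ (fun σ ↦ ρ.toLocal w σ) Q' (fun σ ↦ (hQ'' σ).1)
    (i₀ := σ₀) ((hQ'' σ₀).2 hσ₀).1 h00
  refine ⟨Q, fun σ ↦ ⟨(hQ σ).1, fun hσ ↦ ?_⟩⟩
  have h := (hQ σ).2.2
  rw [((hQ'' σ).2 hσ).1, map_eq_one_iff φ φ.injective] at h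
  exact h

/-- **`Hida2000_thm326_ordinary` ⟺ its `λ`-adic shape at the places of the coefficient fields,
granted Deligne's theorem there.**  Hypothesis `hpl`: Deligne's theorem for newforms at the finite
places of their coefficient fields (Diamond–Shurman, Thm. 9.6.5; the `newformPlaces` shape of the
named fact `DeligneSerre1974.thm61_exists_adicGaloisRep`, see
`DeligneSerre1974.thm61_exists_adicGaloisRep_iff_newformPlaces`).  Then the tree's `ℚ̄_p`-form of
Hida's Thm. 3.26 (2) holds iff, for every newform `g`, `k ≥ 2`, every place `v` of `K_g` above a
prime `p ∤ N` with `v(a_p(g)) = 1` and the place `w = p` of `ℚ`, some `ρ` over `(K_g)_v` attached to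
`g` through `K_g → (K_g)_v` away from `N p` is upper triangular on `Γ_{ℚ_p}` in some frame with
lower-right entry `1` on inertia (Wiles 1988, Thm. 2.1.4, bare inertial content):
`⇐` is `Hida2000_thm326_ordinary_of_newformPlaces` (and does not need `hpl`), `⇒` is
`Hida2000_thm326_ordinary.exists_frame_adicCompletion` applied to the representation of `hpl`.
[cite: Hida2000, Thm. 3.26 (2), p. 152] [cite: DiamondShurman2005, Thm. 9.6.5] -/
theorem Hida2000_thm326_ordinary_iff_newformPlaces
    (hpl : ∀ {N : ℕ} [NeZero N] {k : ℤ} {g : CuspForm (Gamma1 N) k}, 2 ≤ k → IsNewform1 g →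
      ∀ [NumberField (coeffCharField g)] (v : HeightOneSpectrum (𝓞 (coeffCharField g))) (ℓ : ℕ),
        ℓ.Prime → ((ℓ : ℕ) : 𝓞 (coeffCharField g)) ∈ v.asIdeal →
        ∃ ρ : FramedGaloisRep ℚ (v.adicCompletion (coeffCharField g)) 2,
          IsGaloisRepOfNewform1 g
            (algebraMap (coeffCharField g) (v.adicCompletion (coeffCharField g)))
            {q | q ∣ N * ℓ} ρ) :
    Hida2000_thm326_ordinary ↔
      ∀ {N : ℕ} [NeZero N] {k : ℤ} {g : CuspForm (Gamma1 N) k}, 2 ≤ k → IsNewform1 g →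
      ∀ [NumberField (coeffCharField g)] (v : HeightOneSpectrum (𝓞 (coeffCharField g))) (p : ℕ),
        p.Prime → ((p : ℕ) : 𝓞 (coeffCharField g)) ∈ v.asIdeal → ¬ p ∣ N →
        v.valuation (coeffCharField g)
            ⟨(qExpansion 1 ⇑g).coeff p, cuspCoeff_mem_coeffCharField g p⟩ = 1 →
        ∀ w : HeightOneSpectrum (𝓞 ℚ), (p : 𝓞 ℚ) ∈ w.asIdeal →
        ∃ ρ : FramedGaloisRep ℚ (v.adicCompletion (coeffCharField g)) 2,
          IsGaloisRepOfNewform1 g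
            (algebraMap (coeffCharField g) (v.adicCompletion (coeffCharField g)))
            {q | q ∣ N * p} ρ ∧
          ∃ Q : GL (Fin 2) (v.adicCompletion (coeffCharField g)), ∀ σ,
            (Q⁻¹ * ρ.toLocal w σ * Q).val 1 0 = 0 ∧
            (σ ∈ absInertia (w.adicCompletion ℚ) → (Q⁻¹ * ρ.toLocal w σ * Q).val 1 1 = 1) :=
  ⟨fun h _ _ _ _ hk hg _ v p hp hpv hpN hord w hw ↦ by
      obtain ⟨ρ, hρ⟩ := hpl hk hg v p hp hpv
      exact ⟨ρ, hρ, h.exists_frame_adicCompletion hk hg v hp hpv hpN hord hw hρ⟩,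
    fun h ↦ Hida2000_thm326_ordinary_of_newformPlaces h⟩

end AdicShapeConverse

end Literature.NumberTheory.EllipticCurves

end
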